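import Mathlib.Analysis.Complex.ExponentialBounds
import Mathlib.Analysis.Real.Pi.Bounds
import Mathlib.Analysis.SpecialFunctions.Pow.Real
import Mathlib.Analysis.SpecialFunctions.Log.Basic
import Mathlib.Data.Nat.Factorial.Basic
import HarnessLib

/-!
# Javanpeykar 2014, §3.4–3.5: the explicit constants of the Merkl atlas of a Belyi cover
# (`s₁ = √(1/2)`, `r₁`, `6378027`, `13`, `6378028`)

Topic `NumberTheory/DiophantineGeometry`; companion of `BelyiDegreeFaltingsHeight.lean` (the named
fact `javanpeykar2014_stableFaltingsHeight_le`, Thm. 1.1.1 row 1 of A. Javanpeykar, *Polynomial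
bounds for Arakelov invariants of Belyi curves*, Algebra & Number Theory **8** (2014),
arXiv:1403.6404) and of `BelyiDegreeFaltingsHeightProofs.lean` (Lemma 3.2.2, `deg π ≥ 3`). The
archimedean half of the printed proof runs through a "Merkl atlas" `({(V_y, w_y)}, r₁, M, c₁)` of
the Belyi cover `π : Y → X(2)` (Def. 3.1.1, Thm. 3.1.2 = Merkl's theorem with Bruin's constants)
with `s₁ = √(1/2)`, `r₁^{deg π} = s₁`, `n = #cusps ≤ 3 deg π`, `M = 4 deg(π) e^{3π}`,
`c₁ = 128 e^{3π} deg(π)⁴/(π² g)`, and every numerical claim made about these constants in §3.4–3.5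
is CHECKED here as a theorem about real numbers (the objects themselves — Riemann surfaces,
Arakelov–Green functions, the hyperbolic metric — are not available):

* Def. 3.4.4 / proof of Thm. 3.4.5: `sqrt_half_mem_Ioo` (`1/2 < s₁ < 1`),
  `sqrt_half_lt_sqrt_three_div_two` (`s₁ < √3/2`, so the `B_κ^{s₁}` cover `X(2)`), `r₁_bounds`
  (`r₁^d = s₁ ⇒ 1/2 < r₁ < 1` and **`1/(1 - r₁) ≤ d/(1 - s₁)`**, Bernoulli);
* **`thm345_constant`** — "Note that
  `330 n/(1 - r₁)^{3/2} log(1/(1 - r₁)) + 13.2 n c₁ + (n - 1) log M ≤ 6378027 d⁵/g`": TRUE, with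
  `n ≤ 3d`, `1 ≤ g ≤ d` (Lemma 3.2.2) and the Bernoulli bound; here via `e^{3π} ≤ 12392.2`,
  `π² ≥ 9.8695`, `1/(1 - s₁) ≤ 3.4143` the three terms are `≤ 7684 d⁴`, `≤ 6364433 d⁵/g`,
  `≤ 33 d⁴` (the printed constant has about `0.06 %` to spare);
* **`prop351_constant`**, `thirteen_mul_sq_le_pow_five`, `prop351_final` — the closing arithmetic of
  Prop. 3.5.1: `g log(g!) + g² log(1/(1 - r₁)) + (g/2) log(256 g e^{3π}/π²) + 2 g log d ≤ 13 g d²`,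
  `13 g d² ≤ g d⁵` for `d ≥ 3`, and `(g(g+1)/2)·6378027 d⁵/g + g d⁵ ≤ 6378028 g d⁵`;
* the numerical inputs `exp_pi_le` (`e^π ≤ 23.141`), `exp_three_pi_le`, `pi_sq_ge`, `log_const_le`
  (`log 321440 ≤ 12.69`), `log_one_div_one_sub_sqrt_half_le` (`log(1/(1 - s₁)) ≤ 1.23`).

The constants of §4 (Lemma 4.2.3, Prop. 4.2.4, Thm. 4.5.1, Thm. 4.5.2, §4.6: `6378031`, `6378033`,
`13·10⁶`) are in the sibling `BelyiHeightBoundConstants.lean`. No definition, no named fact.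

## References

* A. Javanpeykar, *Polynomial bounds for Arakelov invariants of Belyi curves* (appendix by
  P. Bruin), Algebra & Number Theory 8 (2014), no. 1, 89–140, doi:10.2140/ant.2014.8.89,
  arXiv:1403.6404: Def. 3.1.1, Thm. 3.1.2, Def. 3.4.4, Thm. 3.4.5, Prop. 3.5.1. [Javanpeykar2014]
-/

noncomputable section

open Real

namespace Literature.NumberTheory.DiophantineGeometry

namespace Javanpeykar2014

/-! ### Numerical constants: `e^{3π} ≤ 12392.2`, `π² ≥ 9.8695`, `s₁ = √(1/2)` -/

/-- `e^π ≤ 23.141`. [folklore] -/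
theorem exp_pi_le : exp π ≤ 23.141 := by
  have hπ : π ≤ 3 + 0.1416 := by have := pi_lt_d4; linarith
  have h1 : exp π ≤ exp (3 + 0.1416) := exp_le_exp.mpr hπ
  rw [exp_add, show (3 : ℝ) = 1 + 1 + 1 by norm_num, exp_add, exp_add] at h1
  have he := exp_one_lt_d9
  have he0 := exp_pos (1 : ℝ)
  have hsmall : exp 0.1416 ≤ 1.15212 := by
    have h := Real.exp_bound' (x := 0.1416) (by norm_num) (by norm_num) (n := 4) (by norm_num)
    refine h.trans ?_
    simp only [Finset.sum_range_succ, Finset.sum_range_zero, Nat.factorial]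
    norm_num
  have h3 : exp 1 * exp 1 * exp 1 ≤ 2.7182818286 ^ 3 := by
    have : exp 1 * exp 1 * exp 1 = exp 1 ^ 3 := by ring
    rw [this]
    exact pow_le_pow_left₀ he0.le he.le 3
  calc exp π ≤ exp 1 * exp 1 * exp 1 * exp 0.1416 := h1
    _ ≤ 2.7182818286 ^ 3 * 1.15212 :=
        mul_le_mul h3 hsmall (exp_pos _).le (by positivity)
    _ ≤ 23.141 := by norm_num

/-- `e^{3π} ≤ 12392.2`. [folklore] -/
theorem exp_three_pi_le : exp (3 * π) ≤ 12392.2 := by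
  rw [show 3 * π = (3 : ℕ) * π by norm_num, exp_nat_mul]
  exact (pow_le_pow_left₀ (exp_pos _).le exp_pi_le 3).trans (by norm_num)

/-- `π² ≥ 9.8695`. [folklore] -/
theorem pi_sq_ge : 9.8695 ≤ π ^ 2 := by
  have := pi_gt_d6
  nlinarith

/-- `3π ≤ 9.4248`. [folklore] -/
theorem three_pi_le : 3 * π ≤ 9.4248 := by have := pi_lt_d6; linarith

/-- `√(1/2) ≤ 0.70711`, so `1/(1 - s₁) ≤ 3.4143` for `s₁ = √(1/2)`. [folklore] -/
theorem sqrt_half_le : Real.sqrt (1 / 2) ≤ 0.70711 := by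
  rw [Real.sqrt_le_left (by norm_num)]
  norm_num

/-- `1/2 < s₁ = √(1/2) < 1` ("Note that `1/2 < s₁ < 1`"). [cite: Javanpeykar2014, Def. 3.4.4] -/
theorem sqrt_half_mem_Ioo : Real.sqrt (1 / 2) ∈ Set.Ioo (1 / 2 : ℝ) 1 := by
  constructor
  · rw [Real.lt_sqrt (by norm_num)]
    norm_num
  · rw [Real.sqrt_lt' one_pos]
    norm_num

/-- `s₁ = √(1/2) < √3/2` (so the discs `B_κ^{s₁}` cover `X(2)`).
[cite: Javanpeykar2014, Thm. 3.4.5 (proof)] -/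
theorem sqrt_half_lt_sqrt_three_div_two : Real.sqrt (1 / 2) < Real.sqrt 3 / 2 := by
  have h4 : Real.sqrt 4 = 2 := by
    rw [show (4 : ℝ) = 2 ^ 2 by norm_num, Real.sqrt_sq (by norm_num)]
  rw [show Real.sqrt 3 / 2 = Real.sqrt (3 / 4) by rw [Real.sqrt_div (by norm_num), h4]]
  exact Real.sqrt_lt_sqrt (by norm_num) (by norm_num)

/-- `1/(1 - s₁) ≤ 3.4143`. [folklore] -/
theorem one_div_one_sub_sqrt_half_le : 1 / (1 - Real.sqrt (1 / 2)) ≤ 3.4143 := by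
  have h := sqrt_half_le
  rw [div_le_iff₀ (by linarith)]
  linarith

/-- `log (1/(1 - s₁)) ≤ 1.23`. [folklore] -/
theorem log_one_div_one_sub_sqrt_half_le : Real.log (1 / (1 - Real.sqrt (1 / 2))) ≤ 1.23 := by
  have hpos : 0 < 1 / (1 - Real.sqrt (1 / 2)) := by
    have := sqrt_half_mem_Ioo.2; positivity
  rw [Real.log_le_iff_le_exp hpos]
  refine one_div_one_sub_sqrt_half_le.trans ?_
  have h := Real.sum_le_exp_of_nonneg (x := 1.23) (by norm_num) 6
  refine le_trans ?_ h
  simp only [Finset.sum_range_succ, Finset.sum_range_zero, Nat.factorial]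
  norm_num

/-! ### `r₁`: `r₁^{deg π} = s₁`, `1/2 < r₁ < 1`, `1/(1 - r₁) ≤ deg π/(1 - s₁)` -/

/-- **Bernoulli**: if `0 ≤ r ≤ 1`, `d ≥ 1` and `r ^ d = s`, then `1 - s ≤ d (1 - r)`. [folklore] -/
theorem one_sub_le_mul_one_sub {r s : ℝ} {d : ℕ} (hr0 : 0 ≤ r) (hrd : r ^ d = s) :
    1 - s ≤ d * (1 - r) := by
  have h := one_add_mul_le_pow (show (-2 : ℝ) ≤ r - 1 by linarith) d
  rw [add_sub_cancel, hrd] at h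
  linarith

/-- For `r₁` with `r₁ ^ d = s₁ = √(1/2)`, `0 ≤ r₁`, `d ≥ 1`: **`1/2 < r₁ < 1`** and
**`1/(1 - r₁) ≤ d/(1 - s₁)`** ("Note that `1/2 < r₁ < 1`"; "Moreover `1/(1 - r₁) ≤ d/(1 - s₁)`").
[cite: Javanpeykar2014, Def. 3.4.4 and Thm. 3.4.5 (proof)] -/
theorem r₁_bounds {r₁ : ℝ} {d : ℕ} (hd : 1 ≤ d) (hr0 : 0 ≤ r₁) (hrd : r₁ ^ d = Real.sqrt (1 / 2)) :
    1 / 2 < r₁ ∧ r₁ < 1 ∧ 1 / (1 - r₁) ≤ d / (1 - Real.sqrt (1 / 2)) := by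
  obtain ⟨hs1, hs2⟩ := sqrt_half_mem_Ioo
  have hr1 : r₁ < 1 := by
    by_contra h
    have h1 : 1 ≤ r₁ := not_lt.mp h
    have : (1 : ℝ) ≤ r₁ ^ d := one_le_pow₀ h1
    linarith
  have hrhalf : 1 / 2 < r₁ := by
    by_contra h
    have h1 : r₁ ≤ 1 / 2 := not_lt.mp h
    have : r₁ ^ d ≤ r₁ ^ 1 := pow_le_pow_of_le_one hr0 hr1.le hd
    rw [pow_one] at this
    linarith
  refine ⟨hrhalf, hr1, ?_⟩
  have hB := one_sub_le_mul_one_sub hr0 hrd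
  rw [div_le_div_iff₀ (by linarith) (by linarith), one_mul]
  linarith

/-! ### Thm. 3.4.5: the constant `6378027` of the Merkl atlas of a Belyi cover -/

/-- `log 4 ≤ 1.3864`. [folklore] -/
theorem log_four_le : Real.log 4 ≤ 1.3864 := by
  rw [show (4 : ℝ) = 2 ^ 2 by norm_num, Real.log_pow]
  have := Real.log_two_lt_d9
  push_cast
  linarith

/-- For `u = 1/(1 - r₁) ≤ d/(1 - s₁)` (`d ≥ 1`): `0 < u`, `u ≤ 3.4143 d`, `√u ≤ 1.848 d` and
`0 ≤ log u ≤ d + 0.23`. [cite: Javanpeykar2014, Thm. 3.4.5 (proof)] -/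
theorem u_bounds {r₁ d : ℝ} (hd : 1 ≤ d) (hr : 1 / 2 < r₁) (hr1 : r₁ < 1)
    (hu : 1 / (1 - r₁) ≤ d / (1 - Real.sqrt (1 / 2))) :
    1 ≤ 1 / (1 - r₁) ∧ 1 / (1 - r₁) ≤ 3.4143 * d ∧ Real.sqrt (1 / (1 - r₁)) ≤ 1.848 * d ∧
      0 ≤ Real.log (1 / (1 - r₁)) ∧ Real.log (1 / (1 - r₁)) ≤ d + 0.23 := by
  set u := 1 / (1 - r₁) with hu_def
  have ht : 0 < 1 - r₁ := by linarith
  have hu1 : 1 ≤ u := by rw [hu_def, le_div_iff₀ ht]; linarith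
  have hu0 : 0 < u := by linarith
  have hs := one_div_one_sub_sqrt_half_le
  have hs0 : 0 < 1 / (1 - Real.sqrt (1 / 2)) := by have := sqrt_half_mem_Ioo.2; positivity
  have hdiv : d / (1 - Real.sqrt (1 / 2)) = d * (1 / (1 - Real.sqrt (1 / 2))) := by ring
  have huU : u ≤ 3.4143 * d := by
    refine hu.trans ?_
    rw [hdiv]
    nlinarith
  have hsqrt : Real.sqrt u ≤ 1.848 * d := by
    rw [Real.sqrt_le_left (by positivity)]
    nlinarith
  have hlog0 : 0 ≤ Real.log u := Real.log_nonneg hu1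
  have hlog : Real.log u ≤ d + 0.23 := by
    have h1 : Real.log u ≤ Real.log (d / (1 - Real.sqrt (1 / 2))) := Real.log_le_log hu0 hu
    rw [hdiv, Real.log_mul (by linarith) hs0.ne'] at h1
    have h2 := Real.log_le_sub_one_of_pos (by linarith : (0 : ℝ) < d)
    have h3 := log_one_div_one_sub_sqrt_half_le
    linarith
  exact ⟨hu1, huU, hsqrt, hlog0, hlog⟩

/-- `(1 - r₁)^{3/2} = (1 - r₁) √(1 - r₁)`, so `1/(1 - r₁)^{3/2} = u √u` for `u = 1/(1 - r₁)`.
[folklore] -/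
theorem one_div_rpow_three_halves {r₁ : ℝ} (hr1 : r₁ < 1) :
    1 / (1 - r₁) ^ (3 / 2 : ℝ) = 1 / (1 - r₁) * Real.sqrt (1 / (1 - r₁)) := by
  have ht : 0 < 1 - r₁ := by linarith
  have h32 : (1 - r₁) ^ (3 / 2 : ℝ) = (1 - r₁) * Real.sqrt (1 - r₁) := by
    rw [show (3 / 2 : ℝ) = 1 + 1 / 2 by norm_num, Real.rpow_add ht, Real.rpow_one,
      Real.sqrt_eq_rpow]
  rw [h32, Real.sqrt_div' 1 ht.le, Real.sqrt_one, div_mul_div_comm, one_mul]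

/-- **The constant of Thm. 3.4.5.** With `d = deg π ≥ 1`, `1 ≤ g ≤ d` (Lemma 3.2.2),
`n = #cusps ≤ 3d`, `1/2 < r₁ < 1` with `1/(1 - r₁) ≤ d/(1 - s₁)` (`r₁^d = s₁ = √(1/2)`,
`r₁_bounds`),
`M = 4 d e^{3π}` and `c₁ = 128 e^{3π} d⁴/(π² g)`:
`330 n/(1 - r₁)^{3/2} · log(1/(1 - r₁)) + 13.2 n c₁ + (n - 1) log M ≤ 6378027 d⁵/g`
("Note that …", the verification making `({(V_y, w_y)}, r₁, M, c₁)` a Merkl atlas with the bound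
of Thm. 3.4.5 via Merkl's Thm. 3.1.2; here with `e^{3π} ≤ 12392.2`, `π² ≥ 9.8695`,
`1/(1 - s₁) ≤ 3.4143`: the three terms are `≤ 7684 d⁴`, `≤ 6364433 d⁵/g`, `≤ 33 d⁴`).
[cite: Javanpeykar2014, Thm. 3.4.5 (proof)] -/
theorem thm345_constant {n d g r₁ : ℝ} (hn : n ≤ 3 * d) (hg : 1 ≤ g) (hgd : g ≤ d)
    (hr : 1 / 2 < r₁) (hr1 : r₁ < 1) (hu : 1 / (1 - r₁) ≤ d / (1 - Real.sqrt (1 / 2))) :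
    330 * n / (1 - r₁) ^ (3 / 2 : ℝ) * Real.log (1 / (1 - r₁)) +
        13.2 * n * (128 * exp (3 * π) * d ^ 4 / (π ^ 2 * g)) +
      (n - 1) * Real.log (4 * d * exp (3 * π)) ≤ 6378027 * d ^ 5 / g := by
  have hd : 1 ≤ d := hg.trans hgd
  have hd0 : 0 < d := by linarith
  have hg0 : 0 < g := by linarith
  obtain ⟨hu1, huU, hsqrt, hlog0, hlog⟩ := u_bounds hd hr hr1 hu
  have hu0 : 0 ≤ 1 / (1 - r₁) := by linarith
  have hsqrt0 : 0 ≤ Real.sqrt (1 / (1 - r₁)) := Real.sqrt_nonneg _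
  -- term 1
  have hT1 : 330 * n / (1 - r₁) ^ (3 / 2 : ℝ) * Real.log (1 / (1 - r₁)) ≤ 7684 * d ^ 4 := by
    rw [div_eq_mul_one_div (330 * n), one_div_rpow_three_halves hr1]
    have h1 : 1 / (1 - r₁) * Real.sqrt (1 / (1 - r₁)) ≤ 3.4143 * d * (1.848 * d) :=
      mul_le_mul huU hsqrt hsqrt0 (by positivity)
    have h2 : 1 / (1 - r₁) * Real.sqrt (1 / (1 - r₁)) * Real.log (1 / (1 - r₁)) ≤
        3.4143 * d * (1.848 * d) * (d + 0.23) :=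
      mul_le_mul h1 hlog hlog0 (by positivity)
    have h3 : 330 * n ≤ 990 * d := by linarith
    calc 330 * n * (1 / (1 - r₁) * Real.sqrt (1 / (1 - r₁))) * Real.log (1 / (1 - r₁))
        = 330 * n * (1 / (1 - r₁) * Real.sqrt (1 / (1 - r₁)) * Real.log (1 / (1 - r₁))) := by
          ring
      _ ≤ 990 * d * (3.4143 * d * (1.848 * d) * (d + 0.23)) :=
          mul_le_mul h3 h2 (mul_nonneg (mul_nonneg hu0 hsqrt0) hlog0) (by positivity)
      _ ≤ 7684 * d ^ 4 := by nlinarith [pow_pos hd0 3, pow_pos hd0 4]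
  -- term 2
  have hT2 : 13.2 * n * (128 * exp (3 * π) * d ^ 4 / (π ^ 2 * g)) ≤ 6364433 * d ^ 5 / g := by
    have hE := exp_three_pi_le
    have hP := pi_sq_ge
    have hfrac : 128 * exp (3 * π) * d ^ 4 / (π ^ 2 * g) ≤ 160718 * d ^ 4 / g := by
      rw [div_le_div_iff₀ (by positivity) hg0]
      have hd4 : 0 < d ^ 4 := pow_pos hd0 4
      have : 128 * exp (3 * π) * g ≤ 160718 * (π ^ 2 * g) := by nlinarith [exp_pos (3 * π)]
      nlinarith
    calc 13.2 * n * (128 * exp (3 * π) * d ^ 4 / (π ^ 2 * g))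
        ≤ 13.2 * (3 * d) * (160718 * d ^ 4 / g) :=
          mul_le_mul (by linarith) hfrac (by positivity) (by positivity)
      _ = 6364432.8 * d ^ 5 / g := by ring
      _ ≤ 6364433 * d ^ 5 / g := by
          apply div_le_div_of_nonneg_right _ hg0.le
          nlinarith [pow_pos hd0 5]
  -- term 3
  have hT3 : (n - 1) * Real.log (4 * d * exp (3 * π)) ≤ 33 * d ^ 4 := by
    have hM : Real.log (4 * d * exp (3 * π)) = Real.log 4 + Real.log d + 3 * π := by
      rw [Real.log_mul (by positivity) (exp_pos _).ne', Real.log_mul (by norm_num) hd0.ne',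
        Real.log_exp]
    have hM0 : 0 ≤ Real.log (4 * d * exp (3 * π)) := by
      rw [hM]
      have := Real.log_nonneg (by norm_num : (1 : ℝ) ≤ 4)
      have := Real.log_nonneg hd
      have := pi_pos
      linarith
    have hMle : Real.log (4 * d * exp (3 * π)) ≤ d + 9.82 := by
      rw [hM]
      have := log_four_le
      have := three_pi_le
      have := Real.log_le_sub_one_of_pos hd0
      linarith
    have hd1 : d ≤ d ^ 4 := le_self_pow₀ hd (by norm_num)
    have hd2 : d ^ 2 ≤ d ^ 4 := pow_le_pow_right₀ hd (by norm_num)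
    calc (n - 1) * Real.log (4 * d * exp (3 * π)) ≤ (3 * d) * (d + 9.82) :=
          mul_le_mul (by linarith) hMle hM0 (by positivity)
      _ = 3 * d ^ 2 + 29.46 * d := by ring
      _ ≤ 33 * d ^ 4 := by linarith
  -- `d⁴ ≤ d⁵/g`
  have h45 : d ^ 4 ≤ d ^ 5 / g := by
    rw [le_div_iff₀ hg0]; nlinarith [pow_pos hd0 4]
  have h5g : 0 ≤ d ^ 5 / g := by positivity
  have hsum : 7684 * d ^ 4 + 6364433 * d ^ 5 / g + 33 * d ^ 4 ≤ 6378027 * d ^ 5 / g := by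
    have : 6378027 * d ^ 5 / g = 6364433 * d ^ 5 / g + 13594 * (d ^ 5 / g) := by ring
    rw [this]
    linarith
  linarith

/-! ### Prop. 3.5.1: `log |W_{w_y}(ω)(b)| ≤ 13 g (deg π)² ≤ g (deg π)⁵` -/

/-- `log (256 · 12392.2/9.8695) ≤ 12.69`, precisely `log 321440 ≤ 12.69`. [folklore] -/
theorem log_const_le : Real.log 321440 ≤ 12.69 := by
  rw [Real.log_le_iff_le_exp (by norm_num)]
  have h1 : (12.69 : ℝ) = 12 * 1 + 0.69 := by norm_num
  rw [h1, exp_add, show (12 : ℝ) * 1 = ((12 : ℕ) : ℝ) * 1 by norm_num, exp_nat_mul]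
  have he := exp_one_gt_d9
  have h12 : (2.7182818283 : ℝ) ^ 12 ≤ exp 1 ^ 12 := pow_le_pow_left₀ (by norm_num) he.le 12
  have hsmall : (1.9935 : ℝ) ≤ exp 0.69 := by
    have h := Real.sum_le_exp_of_nonneg (x := 0.69) (by norm_num) 6
    refine le_trans ?_ h
    simp only [Finset.sum_range_succ, Finset.sum_range_zero, Nat.factorial]
    norm_num
  calc (321440 : ℝ) ≤ 2.7182818283 ^ 12 * 1.9935 := by norm_num
    _ ≤ exp 1 ^ 12 * exp 0.69 := mul_le_mul h12 hsmall (by norm_num) (by positivity)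

/-- `log (256 g e^{3π}/π²) ≤ g + 11.69` for `g ≥ 1`. [folklore] -/
theorem log_wronskian_const_le {g : ℝ} (hg : 1 ≤ g) :
    Real.log (256 * g * exp (3 * π) / π ^ 2) ≤ g + 11.69 := by
  have hE := exp_three_pi_le
  have hP := pi_sq_ge
  have hπ2 : 0 < π ^ 2 := by positivity
  have hg0 : 0 < g := by linarith
  have hle : 256 * g * exp (3 * π) / π ^ 2 ≤ 321440 * g := by
    rw [div_le_iff₀ hπ2]
    nlinarith [exp_pos (3 * π)]
  have h1 : Real.log (256 * g * exp (3 * π) / π ^ 2) ≤ Real.log (321440 * g) :=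
    Real.log_le_log (by positivity) hle
  rw [Real.log_mul (by norm_num) hg0.ne'] at h1
  have h2 := log_const_le
  have h3 := Real.log_le_sub_one_of_pos hg0
  linarith

/-- **The constant `13` of Prop. 3.5.1.** For integers `1 ≤ g ≤ d` (Lemma 3.2.2), `d ≥ 1`, and
`1/(1 - r₁) ≤ d/(1 - s₁)` as above:
`g log(g!) + g² log(1/(1 - r₁)) + (g/2) log(256 g e^{3π}/π²) + 2 g log d ≤ 13 g d²`
(the last two displayed steps of the proof of Prop. 3.5.1 — Hadamard's inequality and Cauchy's
estimate `|f_k^{(l)}(b)| ≤ g!/(1 - r₁)^g · sup|f_k|` with `sup Σ|f_k|² ≤ 256 e^{3π} d⁴/π²` having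
produced the left-hand side). [cite: Javanpeykar2014, Prop. 3.5.1 (proof)] -/
theorem prop351_constant {g d : ℕ} (hg : 1 ≤ g) (hgd : g ≤ d) {r₁ : ℝ} (hr : 1 / 2 < r₁)
    (hr1 : r₁ < 1) (hu : 1 / (1 - r₁) ≤ d / (1 - Real.sqrt (1 / 2))) :
    g * Real.log (g.factorial) + (g : ℝ) ^ 2 * Real.log (1 / (1 - r₁)) +
        g / 2 * Real.log (256 * g * exp (3 * π) / π ^ 2) + 2 * g * Real.log d ≤
      13 * g * (d : ℝ) ^ 2 := by
  have hg' : (1 : ℝ) ≤ g := by exact_mod_cast hg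
  have hgd' : (g : ℝ) ≤ d := by exact_mod_cast hgd
  have hd : (1 : ℝ) ≤ d := hg'.trans hgd'
  have hg0 : (0 : ℝ) < g := by linarith
  have hd0 : (0 : ℝ) < d := by linarith
  obtain ⟨-, -, -, hlog0, hlog⟩ := u_bounds hd hr hr1 hu
  have hlogd : Real.log d ≤ d - 1 := Real.log_le_sub_one_of_pos hd0
  have hlogd0 : 0 ≤ Real.log (d : ℝ) := Real.log_nonneg hd
  have hlogg : Real.log g ≤ Real.log d := Real.log_le_log hg0 hgd'
  -- term A: `g log g! ≤ g² log g ≤ g d (d - 1)`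
  have hA : (g : ℝ) * Real.log (g.factorial) ≤ (g : ℝ) * d * (d - 1) := by
    -- `log g! ≤ g log g` (`g! ≤ g^g`)
    have h1 : Real.log (g.factorial) ≤ g * Real.log g := by
      rw [← Real.log_pow]
      exact Real.log_le_log (by exact_mod_cast Nat.factorial_pos g)
        (by exact_mod_cast Nat.factorial_le_pow g)
    have h2 : (g : ℝ) * Real.log g ≤ (d : ℝ) * (d - 1) := by
      calc (g : ℝ) * Real.log g ≤ (g : ℝ) * Real.log d := by gcongr
        _ ≤ (d : ℝ) * (d - 1) := mul_le_mul hgd' hlogd hlogd0 hd0.le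
    calc (g : ℝ) * Real.log (g.factorial) ≤ (g : ℝ) * (g * Real.log g) := by gcongr
      _ ≤ (g : ℝ) * (d * (d - 1)) := by gcongr
      _ = (g : ℝ) * d * (d - 1) := by ring
  -- term B
  have hB : (g : ℝ) ^ 2 * Real.log (1 / (1 - r₁)) ≤ (g : ℝ) * d * (d + 0.23) := by
    calc (g : ℝ) ^ 2 * Real.log (1 / (1 - r₁)) ≤ (g : ℝ) ^ 2 * (d + 0.23) := by gcongr
      _ = (g : ℝ) * g * (d + 0.23) := by ring
      _ ≤ (g : ℝ) * d * (d + 0.23) := by gcongr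
  -- term C
  have hC : (g : ℝ) / 2 * Real.log (256 * g * exp (3 * π) / π ^ 2) ≤
      (g : ℝ) / 2 * (d + 11.69) := by
    have := log_wronskian_const_le hg'
    have : Real.log (256 * g * exp (3 * π) / π ^ 2) ≤ (d : ℝ) + 11.69 := by linarith
    gcongr
  -- term D
  have hD : 2 * (g : ℝ) * Real.log d ≤ 2 * (g : ℝ) * (d - 1) := by gcongr
  nlinarith

/-- **`13 g d² ≤ g d⁵`** for `d ≥ 3` ("Since `g ≥ 1` and `π : Y → X(2)` is a Belyi cover, the
inequality `deg π ≥ 3` holds. Thus `13 g (deg π)² ≤ 13 g (deg π)⁵/27 ≤ g (deg π)⁵`").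
[cite: Javanpeykar2014, Prop. 3.5.1 (proof)] -/
theorem thirteen_mul_sq_le_pow_five {g d : ℝ} (hg : 0 ≤ g) (hd : 3 ≤ d) :
    13 * g * d ^ 2 ≤ g * d ^ 5 := by
  have h27 : 27 ≤ d ^ 3 := by
    have := pow_le_pow_left₀ (by norm_num) hd 3
    norm_num at this
    exact this
  have : g * d ^ 5 = g * d ^ 2 * d ^ 3 := by ring
  rw [this]
  nlinarith [mul_nonneg hg (sq_nonneg d)]

/-- **The constant of Prop. 3.5.1**: `(g(g+1)/2) · 6378027 d⁵/g + g d⁵ ≤ 6378028 g d⁵` — the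
bound `log ‖Wr‖_Ar(b) = log|W(b)| + (g(g+1)/2) log ‖dw_y‖_Ar(b) ≤ g d⁵ + (g(g+1)/2)·6378027 d⁵/g`
`≤ 6378028 g d⁵` for `g ≥ 1`. [cite: Javanpeykar2014, Prop. 3.5.1] -/
theorem prop351_final {g d : ℝ} (hg : 1 ≤ g) (hd : 0 ≤ d) :
    g * (g + 1) / 2 * (6378027 * d ^ 5 / g) + g * d ^ 5 ≤ 6378028 * g * d ^ 5 := by
  have hg0 : g ≠ 0 := by linarith
  have hd5 : 0 ≤ d ^ 5 := by positivity
  have : g * (g + 1) / 2 * (6378027 * d ^ 5 / g) = 6378027 / 2 * (g + 1) * d ^ 5 := by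
    field_simp
  rw [this]
  nlinarith



/-! ### Prop. 3.4.3: the constant `c₁ = 128 e^{3π} (deg π)⁴/(π² g)` (appended) -/

/-- **The arithmetic of Prop. 3.4.3.** With `F_y = F_Γ · e_y²/(2 g π² y_κ² |w_y|²)` (formula
(3.4.3) of the proof), the Jorgenson–Kramer bound `F_Γ ≤ 64 (deg π)²` (Thm. 3.3.2),
`e_y ≤ deg π`, `y_κ > 1/2` on `V_y` ("`y_κ⁻² < 4` on `V_y`") and `|w_y|⁻² ≤ e^{3π}` on `V_y - V_y(2)`:
`F_y ≤ 128 e^{3π} (deg π)⁴/(π² g) = c₁`. [cite: Javanpeykar2014, Prop. 3.4.3 (proof)] -/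
theorem prop343_constant {F e d g y w : ℝ} (hF : F ≤ 64 * d ^ 2) (he0 : 0 ≤ e) (he : e ≤ d) (hg : 0 < g) (hy : 1 / 2 < y) (hw0 : 0 < w) (hw : (w ^ 2)⁻¹ ≤ exp (3 * π)) :
    F * (e ^ 2 / (2 * g * π ^ 2 * y ^ 2 * w ^ 2)) ≤ 128 * exp (3 * π) * d ^ 4 / (π ^ 2 * g) := by
  have hπ : 0 < π ^ 2 := by positivity
  have hy0 : 0 < y := by linarith
  have hy2 : (y ^ 2)⁻¹ < 4 := by
    rw [inv_lt_comm₀ (by positivity) (by norm_num)]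
    nlinarith
  have hw2 : 0 < w ^ 2 := by positivity
  -- rewrite the left side as a product of the four bounded factors
  have e1 : F * (e ^ 2 / (2 * g * π ^ 2 * y ^ 2 * w ^ 2)) =
      F * e ^ 2 * (y ^ 2)⁻¹ * (w ^ 2)⁻¹ / (2 * g * π ^ 2) := by
    field_simp
  rw [e1, div_le_div_iff₀ (by positivity) (by positivity)]
  have h1 : F * e ^ 2 ≤ 64 * d ^ 2 * d ^ 2 :=
    mul_le_mul hF (pow_le_pow_left₀ he0 he 2) (by positivity) (by positivity)
  have h2 : F * e ^ 2 * (y ^ 2)⁻¹ ≤ 64 * d ^ 2 * d ^ 2 * 4 :=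
    mul_le_mul h1 hy2.le (by positivity) (by positivity)
  have h3 : F * e ^ 2 * (y ^ 2)⁻¹ * (w ^ 2)⁻¹ ≤ 64 * d ^ 2 * d ^ 2 * 4 * exp (3 * π) :=
    mul_le_mul h2 hw (by positivity) (by positivity)
  have h4 : 0 < π ^ 2 * g := by positivity
  calc F * e ^ 2 * (y ^ 2)⁻¹ * (w ^ 2)⁻¹ * (π ^ 2 * g)
      ≤ 64 * d ^ 2 * d ^ 2 * 4 * exp (3 * π) * (π ^ 2 * g) :=
        mul_le_mul_of_nonneg_right h3 h4.le
    _ = 128 * exp (3 * π) * d ^ 4 * (2 * g * π ^ 2) := by ring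

end Javanpeykar2014

end Literature.NumberTheory.DiophantineGeometry

end
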